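import Literature.Computability.Cryptography.GapSVPFromGIVP
import HarnessLib

/-!
# `GapSVP` from ANY polynomially short full-rank dual set: the weakest interface of the verifier-free route to `owfExist_of_gapSVP_worstCaseHard`

Topic `Computability/Cryptography` (family `pqc`). Sequel of `GapSVPFromGIVP.lean` (the verifier-free
route to the named fact `Literature.Computability.Cryptography.owfExist_of_gapSVP_worstCaseHard`:
GapSVP with a polynomial factor is decided from a short linearly independent set of DUAL vectors, by
transference). There the reduction `R` was asked for Micciancio–Regev's quality
`‖uᵢ/D‖ ≤ 8β√n · η_{2⁻ⁿ}(L(B)*)` (Cor. 5.13). Since the target fact quantifies over EVERY polynomially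
bounded factor `γ` (chosen after the adversary and its exponent), the assembly needs much less, and
this file records the weakest form, everything PROVED:

* `shortDualOutputs I g` — the good outputs measured against `λ₁` directly: strings
  `⟨bin D, code of (n, U)⟩` (`D ≥ 1`, `U ∈ ℤⁿˣⁿ`) whose rows `uᵢ/D` lie in `L(B)*`, are linearly
  independent, and satisfy `‖uᵢ/D‖ · λ₁(L(B)) ≤ g` — implied by ANY of the usual guarantees
  (`‖S‖ ≤ g' λₙ(L*)` with `λₙ(L*) λ₁(L) ≤ n`, Banaszczyk; `‖S‖ ≤ g' η_{2⁻ⁿ}(L*)` with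
  `η_{2⁻ⁿ}(L*) λ₁(L) ≤ √n`, MR07 Lemma 3.2: `givpDualOutputs_subset_shortDualOutputs`);
* `gapSVP_shortDualTest_of_no` — on a NO instance (`γ d < λ₁`, `g ≤ γ`) every such
  row fails the integer test `D² den(d)² ≤ num(d)² ‖uᵢ‖²` (the YES half,
  `LatticeInstance.gapSVP_dualTest_of_yes`, only uses fullness of rank);
* `gapSVP_restrict_mem_PromiseBPP'_of_shortDual` — the decider `GIVPDual.decF` of
  `GapSVPFromGIVP.lean` puts `GapSVP_γ` restricted to the dimensions in `S'` in `PromiseBPP'` as soon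
  as a PPT `R` outputs a member of `shortDualOutputs I (g n)` with probability `≥ 2/3` and `g ≤ γ`;
* **`owfExist_of_gapSVP_worstCaseHard_of_shortDual`** — the target fact from the hypothesis (inline,
  no named fact): for the SIS′ parameters of the tree's Ajtai step and every PPT SIS′ solver `B`
  succeeding with probability `≥ 1/n^c` on the dimensions in `S`, there are SOME polynomially bounded
  quality `g` and a PPT `R` (polynomial coin budget) that, on the code of any nonsingular `B` of
  dimension `n ∈ S`, `n ≥ n₀`, outputs with probability `≥ 2/3` a member of `shortDualOutputs I (g n)`.
  The factor used is `γ = max 1 g`. `owfExist_of_gapSVP_worstCaseHard_of_givpDual` is the special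
  case `g = 8β n`.

So along this route a worst-case/average-case reduction with ANY polynomial connection factor and
ANY of the standard output guarantees (SIVP/GIVP on the dual) discharges the target.

## References

* D. Micciancio, O. Regev, *Worst-case to average-case reductions based on Gaussian measures*,
  SIAM J. Comput. 37 (2007) 267–302; authors' version: Lemma 3.2 (p. 11), Cor. 5.13 (p. 25),
  Thm. 5.23 (p. 28) and the first step of its proof (p. 29).
* W. Banaszczyk, *New bounds in some transference theorems in the geometry of numbers*, Math. Ann.
  296 (1993), §2 (`1 ≤ λ₁(L) λₙ(L*) ≤ n`).
* M. Ajtai, *Generating hard instances of lattice problems*, STOC 1996, Thm. 1.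
* O. Goldreich, *On promise problems: a survey*, LNCS 3895 (2006), Def. 1.2 (promise-BPP).
-/

noncomputable section

namespace Literature.Computability.Cryptography

open _root_.Computability Polynomial Filter Literature.Computability.Complexity
  Literature.Computability.Complexity.Brick Literature.Algebra.EuclideanLattices
  Literature.Algebra.EuclideanLattices.LLLMachine Literature.Computability.Cryptography.LWE
  Module

/-! ### The NO-side test against `λ₁` -/

/-- **NO instances reject every row of a `λ₁`-short dual set.** If `‖uᵢ/D‖ · λ₁(L(B)) ≤ g ≤ γ` and
`γ d < λ₁(L(B))` (`d = a/b ≥ 0`), then `a² ‖uᵢ‖² < D² b²`, i.e. the integer test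
`D² b² ≤ a² ‖uᵢ‖²` fails: `d ‖uᵢ/D‖ λ₁ ≤ d γ < λ₁`, so `d ‖uᵢ/D‖ < 1`.
[cite: MicciancioRegev2007, Thm. 5.23 (proof, p. 29, first step) with Lemma 3.2] -/
theorem gapSVP_shortDualTest_of_no (I : LatticeInstance) (hI : I.IsNonsingular) (hn : 1 ≤ I.n)
    {ι : Type*} {u : ι → Fin I.n → ℤ} {D : ℕ} (hD : 0 < D) {g γ : ℝ} (hγ : g ≤ γ)
    (hbound : ∀ i, ‖(D : ℝ)⁻¹ • intVecToEuclidean I.n (u i)‖ * minNorm I.lattice ≤ g)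
    {a : ℤ} {b : ℕ} (ha : 0 ≤ a) (hb : 0 < b) (hno : γ * ((a : ℝ) / b) < minNorm I.lattice) (i : ι) :
    (a : ℝ) ^ 2 * ‖intVecToEuclidean I.n (u i)‖ ^ 2 < (D : ℝ) ^ 2 * (b : ℝ) ^ 2 := by
  haveI : IsZLattice ℝ I.lattice := LatticeInstance.isZLattice_of_isNonsingular hI
  haveI : Nontrivial (EuclideanSpace ℝ (Fin I.n)) := by
    haveI : Nonempty (Fin I.n) := ⟨⟨0, hn⟩⟩
    infer_instance
  have hL : I.lattice ≠ ⊥ := by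
    intro h
    have htop : Submodule.span ℝ ((I.lattice : Submodule ℤ _) : Set (EuclideanSpace ℝ (Fin I.n))) = ⊤ :=
      IsZLattice.span_top
    rw [h, Submodule.bot_coe, Submodule.span_zero_singleton] at htop
    exact bot_ne_top htop
  have hlam : 0 < minNorm I.lattice := minNorm_pos_of_ne_bot I.lattice hL
  set d : ℝ := (a : ℝ) / b with hddef
  have hd : 0 ≤ d := div_nonneg (by exact_mod_cast ha) (by positivity)
  set s := (D : ℝ)⁻¹ • intVecToEuclidean I.n (u i) with hsdef
  -- `d ‖s‖ λ₁ ≤ d g ≤ d γ = γ d < λ₁`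
  have h2 : d * ‖s‖ * minNorm I.lattice < 1 * minNorm I.lattice := by
    calc d * ‖s‖ * minNorm I.lattice = d * (‖s‖ * minNorm I.lattice) := by ring
      _ ≤ d * g := mul_le_mul_of_nonneg_left (hbound i) hd
      _ ≤ d * γ := mul_le_mul_of_nonneg_left hγ hd
      _ = γ * d := mul_comm _ _
      _ < minNorm I.lattice := hno
      _ = 1 * minNorm I.lattice := (one_mul _).symm
  have hlt : d * ‖s‖ < 1 := lt_of_mul_lt_mul_right h2 hlam.le
  by_contra hle
  push Not at hle
  exact (lt_irrefl (1 : ℝ)) (lt_of_le_of_lt ((one_le_div_mul_norm_smul_iff (by exact_mod_cast ha)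
    (by exact_mod_cast hb) (by exact_mod_cast hD)).2 hle) hlt)

/-! ### Good outputs measured against `λ₁` -/

/-- The good outputs of a dual-set finder on the instance `I = (n, B)`, quality `g` measured against
`λ₁(L(B))` directly: strings `boolPair (encodeNat D) (LatticeInstance.encode ⟨n, U⟩)` with `D ≥ 1`
and `U ∈ ℤⁿˣⁿ` whose rows `uᵢ/D` belong to `L(B)*`, are linearly independent over `ℝ`, and satisfy
`‖uᵢ/D‖ · λ₁(L(B)) ≤ g`. [cite: MicciancioRegev2007, Thm. 5.23 (proof, p. 29, first step)] -/
def shortDualOutputs (I : LatticeInstance) (g : ℝ) : Set (List Bool) :=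
  {w | ∃ (D : ℕ) (U : Matrix (Fin I.n) (Fin I.n) ℤ),
      w = boolPair (encodeNat D) (LatticeInstance.encode ⟨I.n, U⟩) ∧ 0 < D ∧
      (∀ i, (D : ℝ)⁻¹ • intVecToEuclidean I.n (U i) ∈ dualLattice I.lattice) ∧
      LinearIndependent ℝ (fun i => intVecToEuclidean I.n (U i)) ∧
      ∀ i, ‖(D : ℝ)⁻¹ • intVecToEuclidean I.n (U i)‖ * minNorm I.lattice ≤ g}

/-- **MR07's quality implies the `λ₁` quality with an extra `√n`**: on a nonsingular instance of
positive dimension, `givpDualOutputs I g ⊆ shortDualOutputs I (g √n)`, because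
`η_{2⁻ⁿ}(L*) · λ₁(L) ≤ √n` (MR07 Lemma 3.2 for the dual lattice, `L** = L`).
[cite: MicciancioRegev2007, Lemma 3.2 (p. 11)] -/
theorem givpDualOutputs_subset_shortDualOutputs {I : LatticeInstance} (hI : I.IsNonsingular)
    (hn : 1 ≤ I.n) {g : ℝ} (hg : 0 ≤ g) :
    givpDualOutputs I g ⊆ shortDualOutputs I (g * Real.sqrt I.n) := by
  rintro w ⟨D, U, hw, hD, hmem, hli, hbound⟩
  refine ⟨D, U, hw, hD, hmem, hli, fun i => ?_⟩
  haveI : IsZLattice ℝ I.lattice := LatticeInstance.isZLattice_of_isNonsingular hI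
  haveI : Nontrivial (EuclideanSpace ℝ (Fin I.n)) := by
    haveI : Nonempty (Fin I.n) := ⟨⟨0, hn⟩⟩
    infer_instance
  have h := norm_mul_minNorm_le_of_le_smoothing I.lattice hg
    (x := (D : ℝ)⁻¹ • intVecToEuclidean I.n (U i)) (by rw [finrank_euclideanSpace_fin]; exact hbound i)
  rwa [finrank_euclideanSpace_fin] at h

/-! ### `GapSVP` restricted to a dimension set is in `PromiseBPP'`, given a `λ₁`-short dual set finder -/

open GIVPDual in
/-- **`GapSVP_γ` restricted to a dimension set is in promise-BPP, given a finder of `λ₁`-short dual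
sets.** Let `R` be PPT with coin budget the polynomial `p`, and suppose that on the code of every
nonsingular instance `B` of dimension `n ∈ S'` (`S' ⊆ [1, ∞)`) it outputs with probability `≥ 2/3` a
member of `shortDualOutputs I (g n)`, where `g(n) ≤ γ(n)`. Then `GapSVP_γ` restricted to instances of
dimension in `S'` lies in `PromiseBPP'`: witness language `GIVPDual.decLang R p`, coin polynomial `p`;
on a YES instance the good runs accept (`gapSVP_dualTest_of_yes`), on a NO instance they reject
(`gapSVP_shortDualTest_of_no`); the probability is transported by `RandAlg.pr_eq_uniformProb` and
`uniformProb_take_of_le`. Same proof as `gapSVP_restrict_mem_PromiseBPP'_of_givpDual`.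
[cite: MicciancioRegev2007, Thm. 5.23 (proof, p. 29, first step); Goldreich 2006 Def. 1.2] -/
theorem gapSVP_restrict_mem_PromiseBPP'_of_shortDual {R : RandAlg (List Bool) (List Bool)}
    (hR : IsPPT R id) {p : Polynomial ℕ} (hcoin : ∀ k, R.coinLen k = p.eval k) {S' : Set ℕ}
    {g γ : ℕ → ℝ} (hγ : ∀ n, g n ≤ γ n) (hS1 : ∀ n ∈ S', 1 ≤ n)
    (hgood : ∀ I : LatticeInstance, I.IsNonsingular → I.n ∈ S' →
      (2 / 3 : ℝ) ≤ R.pr id I.encode (shortDualOutputs I (g I.n))) :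
    PromiseProblem.ofEncoding gapSVPInstanceEncoding
        {q | q ∈ GapSVP.yes γ ∧ q.1.n ∈ S'} {q | q ∈ GapSVP.no γ ∧ q.1.n ∈ S'} ∈ PromiseBPP' := by
  refine ⟨decLang R p, decLang_mem_P R p hR, p, ?_, ?_⟩
  · -- YES instances: good runs accept
    rintro x ⟨⟨I, d⟩, ⟨⟨hI, hd, hyes⟩, hS⟩, rfl⟩
    have hkle : p.eval I.encode.length ≤ p.eval (gapSVPInstanceEncoding.encode (I, d)).length := by
      refine TM2Iter.eval_mono p ?_
      rw [gapSVP_encode_eq, length_boolPair]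
      omega
    have hpr : R.pr id I.encode (shortDualOutputs I (g I.n)) =
        uniformProb (p.eval I.encode.length) {r | R.run I.encode r ∈ shortDualOutputs I (g I.n)} := by
      rw [RandAlg.pr_eq_uniformProb, hcoin]; rfl
    calc (2 / 3 : ℝ) ≤ R.pr id I.encode (shortDualOutputs I (g I.n)) := hgood I hI hS
      _ = uniformProb (p.eval (gapSVPInstanceEncoding.encode (I, d)).length)
            {y' | y'.take (p.eval I.encode.length) ∈
              {r | R.run I.encode r ∈ shortDualOutputs I (g I.n)}} := by
          rw [hpr, uniformProb_take_of_le hkle]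
      _ ≤ _ := PromiseCook.uniformProb_mono ?_
    intro y' hy'
    obtain ⟨D, U, hrun, hD, hmem, hli, -⟩ := hy'
    change decF R p (inp I d y') = [true]
    rw [decF_apply hrun]
    have hn : 1 ≤ I.n := hS1 _ hS
    have hspan : Submodule.span ℝ (Set.range fun i => intVecToEuclidean I.n (U i)) = ⊤ :=
      hli.span_eq_top_of_card_eq_finrank' (by simp)
    have hnum : 0 ≤ d.num := Rat.num_nonneg.2 hd.le
    have hyes' : minNorm I.lattice ≤ (d.num : ℝ) / d.den := by
      convert hyes using 1
      rw [Rat.cast_def]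
    obtain ⟨i, hi⟩ := LatticeInstance.gapSVP_dualTest_of_yes hI hn hD hmem hspan hnum d.den_pos hyes'
    simp only [List.cons.injEq, and_true, decide_eq_true_eq]
    exact ⟨i, (intTest_iff (U i) D d.den d.num).2 hi⟩
  · -- NO instances: good runs reject
    rintro x ⟨⟨I, d⟩, ⟨⟨hI, hd, hno⟩, hS⟩, rfl⟩
    have hkle : p.eval I.encode.length ≤ p.eval (gapSVPInstanceEncoding.encode (I, d)).length := by
      refine TM2Iter.eval_mono p ?_
      rw [gapSVP_encode_eq, length_boolPair]
      omega
    have hpr : R.pr id I.encode (shortDualOutputs I (g I.n)) =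
        uniformProb (p.eval I.encode.length) {r | R.run I.encode r ∈ shortDualOutputs I (g I.n)} := by
      rw [RandAlg.pr_eq_uniformProb, hcoin]; rfl
    calc (2 / 3 : ℝ) ≤ R.pr id I.encode (shortDualOutputs I (g I.n)) := hgood I hI hS
      _ = uniformProb (p.eval (gapSVPInstanceEncoding.encode (I, d)).length)
            {y' | y'.take (p.eval I.encode.length) ∈
              {r | R.run I.encode r ∈ shortDualOutputs I (g I.n)}} := by
          rw [hpr, uniformProb_take_of_le hkle]
      _ ≤ _ := PromiseCook.uniformProb_mono ?_
    intro y' hy'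
    obtain ⟨D, U, hrun, hD, -, -, hbound⟩ := hy'
    change ¬ decF R p (inp I d y') = [true]
    rw [decF_apply hrun]
    have hn : 1 ≤ I.n := hS1 _ hS
    have hnum : 0 ≤ d.num := Rat.num_nonneg.2 hd.le
    have hno' : γ I.n * ((d.num : ℝ) / d.den) < minNorm I.lattice := by
      convert hno using 2
      rw [Rat.cast_def]
    have hlt := fun i => gapSVP_shortDualTest_of_no I hI hn hD (hγ I.n) hbound hnum
      d.den_pos hno' i
    simp only [List.cons.injEq, and_true, decide_eq_true_eq, not_exists]
    intro i hi
    exact (not_le.2 (hlt i)) ((intTest_iff (U i) D d.den d.num).1 hi)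

/-! ### The assembly: the target fact from a `λ₁`-short dual set finder of any polynomial quality -/

/-- **The target fact from a worst-case/average-case reduction of ANY polynomial quality** (the
hypothesis is written inline; no named fact is introduced). HYPOTHESIS: for the tree's rendering of
the SIS′ parameters (`IsPolyBounded q, m`, `IsPolyBoundedReal β`, `IsPolyTimeParams`, `0 < β`,
`MRModulusCondition`) and every PPT `B` solving SIS′_{q,m,β} on the average with probability `≥ 1/n^c`
on the dimensions `n ∈ S`, there exist a polynomially bounded quality `g` and a PPT `R` with a
polynomial coin budget that, on the code of any nonsingular `B` of dimension `n ∈ S`, `n ≥ n₀`, outputs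
with probability `≥ 2/3` a full-rank set of dual vectors `uᵢ/D ∈ L(B)*` with `‖uᵢ/D‖ λ₁(L(B)) ≤ g(n)`
(`shortDualOutputs`) — e.g. Micciancio–Regev's Cor. 5.13 on the dual (quality `8β n`, via
`givpDualOutputs_subset_shortDualOutputs`), or any SIVP_{poly} solver for `L(B)*` (Banaszczyk:
`λₙ(L*) λ₁(L) ≤ n`). CONCLUSION: `owfExist_of_gapSVP_worstCaseHard`. Proof: as
`owfExist_of_gapSVP_worstCaseHard_of_givpDual` (Ajtai's SIS-function step
`Ajtai1996_sisFunction_inverter_to_SIS'_holds`, an infinite set of dimensions with a polynomial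
advantage), with the factor `γ = max 1 g` and `gapSVP_restrict_mem_PromiseBPP'_of_shortDual`.
[cite: MicciancioRegev2007, Thm. 5.23 (proof, p. 29, first step); Ajtai 1996 Thm 1] -/
theorem owfExist_of_gapSVP_worstCaseHard_of_shortDual
    (h : ∀ (q m : ℕ → ℕ) [∀ n, NeZero (q n)] (β : ℕ → ℝ),
      IsPolyBounded q → IsPolyBounded m → IsPolyBoundedReal β → IsPolyTimeParams q β m →
      (∀ n, 0 < β n) → MRModulusCondition q m β →
      ∀ B : RandAlg (List Bool) (List Bool), IsPPT B id → ∀ (c : ℕ) (S : Set ℕ),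
        (∀ n ∈ S, 1 / (n : ℝ) ^ c ≤ SIS.successProb' B n (m n) (q n) (β n)) →
        ∃ g : ℕ → ℝ, IsPolyBoundedReal g ∧
        ∃ R : RandAlg (List Bool) (List Bool), IsPPT R id ∧
          (∃ p : Polynomial ℕ, ∀ k, R.coinLen k = p.eval k) ∧
          ∃ n₀ : ℕ, ∀ I : LatticeInstance, I.IsNonsingular → I.n ∈ S → n₀ ≤ I.n →
            (2 / 3 : ℝ) ≤ R.pr id I.encode (shortDualOutputs I (g I.n))) :
    owfExist_of_gapSVP_worstCaseHard := by
  intro H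
  obtain ⟨q, m, hq0, β, f, nOf, hq, hm, hβ, hpar, hβ1, hmod, hf, hnOf, hred⟩ :=
    Ajtai1996_sisFunction_inverter_to_SIS'_holds
  refine ⟨f, hf, fun A hA => ?_⟩
  by_contra hneg
  -- a polynomial inverse lower bound on an infinite set of security parameters
  obtain ⟨c, hK⟩ := exists_infinite_ge_inv_pow_of_not_superpolynomialDecay
    (fun k => invertProb_nonneg f A k) hneg
  set K : Set ℕ := {k : ℕ | 1 / (k : ℝ) ^ c ≤ invertProb f A k} with hKdef
  -- (F2) an average-case SIS′ solver on the corresponding dimensions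
  obtain ⟨B, hB, c', k₀, hsolve⟩ := hred A hA c
  set S : Set ℕ := nOf '' (K ∩ Set.Ici k₀) with hSdef
  have hSinf : S.Infinite := infinite_image_of_tendsto_atTop hnOf (infinite_inter_Ici hK k₀)
  have hS : ∀ n ∈ S, 1 / (n : ℝ) ^ c' ≤ SIS.successProb' B n (m n) (q n) (β n) := by
    rintro n ⟨k, ⟨hkK, hk₀⟩, rfl⟩
    exact hsolve k hk₀ hkK
  -- the dual-set finder for instances of dimension in `S`
  have hβ0 : ∀ n, 0 < β n := fun n => one_pos.trans_le (hβ1 n)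
  obtain ⟨g, hg, R, hR, ⟨pR, hpR⟩, n₀, hgood⟩ := h q m β hq hm hβ hpar hβ0 hmod B hB c' S hS
  -- the factor `γ = max 1 g` and the dimension set `S ∩ [max n₀ 1, ∞)`
  set γ : ℕ → ℝ := fun n => max 1 (g n) with hγdef
  have hγpoly : IsPolyBoundedReal γ := isPolyBoundedReal_max_one hg
  set S' : Set ℕ := S ∩ Set.Ici (max n₀ 1) with hS'def
  have hmem : PromiseProblem.ofEncoding gapSVPInstanceEncoding
      {q | q ∈ GapSVP.yes γ ∧ q.1.n ∈ S'} {q | q ∈ GapSVP.no γ ∧ q.1.n ∈ S'} ∈ PromiseBPP' := by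
    refine gapSVP_restrict_mem_PromiseBPP'_of_shortDual hR hpR (g := g) (γ := γ)
      (fun n => le_max_right _ _) (fun n hn => ?_) ?_
    · exact le_trans (le_max_right _ _) hn.2
    · intro I hI hIS
      exact hgood I hI hIS.1 (le_trans (le_max_left _ _) hIS.2)
  exact H γ hγpoly (fun n => le_max_left _ _) S' (infinite_inter_Ici hSinf _) hmem

/-- **Cor. 5.13 on the dual is a special case**: the hypothesis of
`owfExist_of_gapSVP_worstCaseHard_of_givpDual` (quality `8β√n` against `η_{2⁻ⁿ}(L*)`) implies the
hypothesis of `owfExist_of_gapSVP_worstCaseHard_of_shortDual` (quality `8β n` against `λ₁`).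
[cite: MicciancioRegev2007, Cor. 5.13 with Lemma 3.2 (proof of Thm. 5.23, first step, p. 29)] -/
theorem shortDual_hypothesis_of_givpDual
    (h : ∀ (q m : ℕ → ℕ) [∀ n, NeZero (q n)] (β : ℕ → ℝ),
      IsPolyBounded q → IsPolyBounded m → IsPolyBoundedReal β → IsPolyTimeParams q β m →
      (∀ n, 0 < β n) → MRModulusCondition q m β →
      ∀ B : RandAlg (List Bool) (List Bool), IsPPT B id → ∀ (c : ℕ) (S : Set ℕ),
        (∀ n ∈ S, 1 / (n : ℝ) ^ c ≤ SIS.successProb' B n (m n) (q n) (β n)) →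
        ∃ R : RandAlg (List Bool) (List Bool), IsPPT R id ∧
          (∃ p : Polynomial ℕ, ∀ k, R.coinLen k = p.eval k) ∧
          ∃ n₀ : ℕ, ∀ I : LatticeInstance, I.IsNonsingular → I.n ∈ S → n₀ ≤ I.n →
            (2 / 3 : ℝ) ≤ R.pr id I.encode (givpDualOutputs I (8 * β I.n * Real.sqrt I.n)))
    (q m : ℕ → ℕ) [∀ n, NeZero (q n)] (β : ℕ → ℝ)
    (hq : IsPolyBounded q) (hm : IsPolyBounded m) (hβ : IsPolyBoundedReal β) (hpar : IsPolyTimeParams q β m)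
    (hβ0 : ∀ n, 0 < β n) (hmod : MRModulusCondition q m β)
    (B : RandAlg (List Bool) (List Bool)) (hB : IsPPT B id) (c : ℕ) (S : Set ℕ)
    (hS : ∀ n ∈ S, 1 / (n : ℝ) ^ c ≤ SIS.successProb' B n (m n) (q n) (β n)) :
    ∃ g : ℕ → ℝ, IsPolyBoundedReal g ∧
    ∃ R : RandAlg (List Bool) (List Bool), IsPPT R id ∧
      (∃ p : Polynomial ℕ, ∀ k, R.coinLen k = p.eval k) ∧
      ∃ n₀ : ℕ, ∀ I : LatticeInstance, I.IsNonsingular → I.n ∈ S → n₀ ≤ I.n →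
        (2 / 3 : ℝ) ≤ R.pr id I.encode (shortDualOutputs I (g I.n)) := by
  obtain ⟨R, hR, hp, n₀, hgood⟩ := h q m β hq hm hβ hpar hβ0 hmod B hB c S hS
  refine ⟨fun n => 8 * β n * n, isPolyBoundedReal_eight_mul_mul hβ, R, hR, hp, max n₀ 1, ?_⟩
  intro I hI hIS hn
  have hn1 : 1 ≤ I.n := le_trans (le_max_right _ _) hn
  have hsub := givpDualOutputs_subset_shortDualOutputs hI hn1 (g := 8 * β I.n * Real.sqrt I.n)
    (by have := (hβ0 I.n).le; positivity)
  have heq : 8 * β I.n * Real.sqrt I.n * Real.sqrt I.n = 8 * β I.n * I.n := by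
    rw [mul_assoc, Real.mul_self_sqrt (Nat.cast_nonneg _)]
  rw [heq] at hsub
  calc (2 / 3 : ℝ) ≤ R.pr id I.encode (givpDualOutputs I (8 * β I.n * Real.sqrt I.n)) :=
        hgood I hI hIS (le_trans (le_max_left _ _) hn)
    _ ≤ R.pr id I.encode (shortDualOutputs I (8 * β I.n * I.n)) := R.pr_mono id I.encode hsub

end Literature.Computability.Cryptography

end
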